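import Literature.NumberTheory.GaloisCohomology.LocalPairingSubgroup
import Literature.NumberTheory.GaloisRepresentations.ContinuousShapiroOpenCoinducedLayerChange
import Literature.NumberTheory.GaloisRepresentations.ContinuousShapiroLiftPairing
import Literature.NumberTheory.GaloisRepresentations.ContinuousShapiroLiftCores
import HarnessLib

/-!
# Route `SignedLowerHalves`, crux L `SmallImageLowerHalfBothSigns` (stmt-BirchSwinnertonDyer-23599), line `rtt_w3` v15 — E2, row J3 residual
# (`RSeq`), brick R1: THE BRIDGE BETWEEN THE TWO MODELS OF THE LAYER PAIRING — `cor_N(a ∪ b) = Sh_N a ∪_{ΣP} Sh_N b` in `H²(G, Z)`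
# (the corestriction model of J3's `pairLoc`/`localPairingSubgroup` IS the Shapiro model of the tree's levelwise Poitou–Tate core)

WIDTH seat `bsd-line-slh-p3-w3` g23 under LEAD `cruxlead-stmt-BirchSwinnertonDyer-23599` g11 (cell `bsd-ssimc`); helper `--supports stmt-BirchSwinnertonDyer-23599`.
ONE DEFINITION WITH BODY (the pointwise pairing of permutation modules) + THEOREMS; no named fact, no instance, no `sorry`. HONEST FRAMING: generic continuous
group cohomology (Serre I §2.5, NSW (1.5.3)(iv), (1.6.4)); nothing arithmetic is proved; E2, crux L, crux M, BSD remain OPEN and are proved for NO curve.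

WHY. J3's layer pairings (`SmallImageRttD2Seq.pairLoc`, p786363) are `inv_{U} (a ∪ b) := inv_v(cor_{Γ_{K_v}/U}(a ∪ b))` (tree `localPairingSubgroup`,
`localInvariantMapSubgroup`: Serre's all-degree corestriction `cor`), while the tree's levelwise Tate–Poitou reciprocity
(`GaloisCohomology.sum_localInvariantMap_cupProduct_shapiroLift_eq_zero_of_resLe_inertia`, any number field) and its Mackey evaluation
(`ContPairing.map_cupProduct_coindFin_shapiroLift_sum`) live in the SHAPIRO model `inv_v(Sh_U a ∪_{ΣP} Sh_U b)`. This file identifies the two: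

* §1 `ContPairing.coindFinPt P N : Maps(G ⧸ N, X) × Maps(G ⧸ N, Y) → Maps(G ⧸ N, Z)`, `(φ, ψ) ↦ (y ↦ P(φ y, ψ y))` (continuous, bilinear, `G`-equivariant);
  `ev₁ ∘ coindFinPt = P|_N ∘ (ev₁ × ev₁)`, `trace ∘ coindFinPt = P.coindFin N` (the tree's SUMMED pairing).
* §2 `map_coindFinEvalAtOne_shapiroLift` (`H¹(N ↪ G, ev₁)(Sh_N a) = a`: the degree-one Shapiro map undoes the Shapiro lift);
  ★★ **`cor_cupProduct_eq_cupProduct_shapiroLift`**: `cor N ρZ 2 ((resPairing N ρX ρY ρZ P).cupProduct a b) = (P.coindFin N).cupProduct (Sh_N a) (Sh_N b)` for a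
  profinite `G`, an open `N ≤ G` of finite index and discrete coefficients — via `cor_N ∘ sh_N = H²(trace)` (tree `ContinuousRep.cor_shapiroCoindFinAddEquiv`) applied to
  `w := Sh a ∪_{pt} Sh b`, whose Shapiro image is `a ∪ b` (naturality of the cup product along `(N ↪ G, ev₁)`) and whose trace image is `Sh a ∪_{ΣP} Sh b`.
* §3 ★★ **`localPairingSubgroup_eq_localInvariantMap_cupProduct_shapiroLift`**: for a number field `K`, a finite place `v`, `n ≥ 1`, an open `S ≤ Γ_{K_v}`:
  `localPairingSubgroup K n v ρX ρY P S a b = localInvariantMap K n v ((P.coindFin S).cupProduct (Sh_S a) (Sh_S b))`.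
References: [SerreGaloisCohomology1997] I §2.5 (Prop. 10, corestriction); [NeukirchSchmidtWingberg2008] I §5 Prop. (1.5.3)(iv), I §6 Prop. (1.6.4)–(1.6.5);
[SerreLocalFields1979] VII §5–§6, XI §2 Prop. 1 (ii).
-/

set_option autoImplicit false
set_option linter.dupNamespace false -- D-0017: single-problem summit, the namespace repeats the problem name by design
noncomputable section

open scoped Classical
open CategoryTheory Function

namespace Summit.BirchSwinnertonDyer.BirchSwinnertonDyer.Theorems.SmallImageRttD2Seq

open Literature.NumberTheory.GaloisRepresentations Literature.NumberTheory.GaloisCohomology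

universe u v

/-! ## §1. The pointwise pairing of permutation modules -/

section Pointwise

variable {R : Type u} [CommRing R] [TopologicalSpace R]
variable {G : Type v} [Group G] [TopologicalSpace G] [IsTopologicalGroup G]
variable {X Y Z : TopRep.{v} R G} (P : ContPairing X Y Z) (N : Subgroup G)

/-- **The pointwise pairing `Maps(G ⧸ N, X) × Maps(G ⧸ N, Y) → Maps(G ⧸ N, Z)`, `(φ, ψ) ↦ (y ↦ P(φ y, ψ y))`** of the permutation modules attached to a
continuous equivariant pairing `P : X × Y → Z` (continuous, `R`-bilinear, `G`-equivariant for the diagonal actions `(g ⋆ φ)(y) = g • φ(g⁻¹ • y)`). Under Shapiro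
its cup product is the cup product of `N`; its trace is the tree's summed pairing `P.coindFin N`. [cite: SerreLocalFields1979, VII §6] [cite: NeukirchSchmidtWingberg2008, I §6 Prop. (1.6.4)] -/
def coindFinPt : ContPairing (coindFin X N) (coindFin Y N) (coindFin Z N) where
  toLin := LinearMap.mk₂ R (fun φ ψ => (fun y : G ⧸ N => P.toLin (φ y) (ψ y) : G ⧸ N → Z))
    (fun φ φ' ψ => by
      funext y
      change P.toLin ((φ + φ') y) (ψ y) = P.toLin (φ y) (ψ y) + P.toLin (φ' y) (ψ y)
      rw [coindFin_add_apply, map_add, LinearMap.add_apply])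
    (fun r φ ψ => by
      funext y
      change P.toLin ((r • φ) y) (ψ y) = r • P.toLin (φ y) (ψ y)
      change P.toLin (r • φ y) (ψ y) = r • P.toLin (φ y) (ψ y)
      rw [map_smul, LinearMap.smul_apply])
    (fun φ ψ ψ' => by
      funext y
      change P.toLin (φ y) ((ψ + ψ') y) = P.toLin (φ y) (ψ y) + P.toLin (φ y) (ψ' y)
      rw [coindFin_add_apply, map_add])
    (fun r φ ψ => by
      funext y
      change P.toLin (φ y) ((r • ψ) y) = r • P.toLin (φ y) (ψ y)
      change P.toLin (φ y) (r • ψ y) = r • P.toLin (φ y) (ψ y)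
      rw [map_smul])
  continuous_toLin := by
    change Continuous fun p : (G ⧸ N → X) × (G ⧸ N → Y) => fun y : G ⧸ N => P.toLin (p.1 y) (p.2 y)
    exact continuous_pi fun y =>
      Continuous.comp (f := fun p : (G ⧸ N → X) × (G ⧸ N → Y) => (p.1 y, p.2 y)) P.continuous_toLin
        (((continuous_apply y).comp continuous_fst).prodMk ((continuous_apply y).comp continuous_snd))
  toLin_smul g φ ψ := by
    funext y
    change P.toLin ((coindFin X N).ρ g φ y) ((coindFin Y N).ρ g ψ y) = (coindFin Z N).ρ g (fun y : G ⧸ N => P.toLin (φ y) (ψ y)) y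
    rw [coindFin_ρ_apply, coindFin_ρ_apply, coindFin_ρ_apply, P.toLin_smul]

omit [TopologicalSpace G] [IsTopologicalGroup G] in
/-- Values of the pointwise pairing. [folklore] -/
@[simp]
theorem coindFinPt_toLin_apply (φ : coindFin X N) (ψ : coindFin Y N) (y : G ⧸ N) :
    (coindFinPt P N).toLin φ ψ y = P.toLin (φ y) (ψ y) :=
  rfl

omit [IsTopologicalGroup G] in
/-- `ev₁(φ ·_{pt} ψ) = P(ev₁ φ, ev₁ ψ)` — the pointwise pairing restricted to `N` is compatible with evaluation at the unit coset (the coefficient map of the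
Shapiro map) and the restricted pairing `P|_N`. [cite: SerreGaloisCohomology1997, I §2.5 Prop. 10] -/
theorem coindFinEvalAtOne_coindFinPt (φ : coindFin X N) (ψ : coindFin Y N) :
    (coindFinEvalAtOne Z N).hom ((coindFinPt P N).toLin φ ψ) =
      (P.restrict (subgroupIncl N)).toLin ((coindFinEvalAtOne X N).hom φ) ((coindFinEvalAtOne Y N).hom ψ) :=
  rfl

end Pointwise

/-! ## §2. `cor_N(a ∪ b) = Sh_N a ∪_{ΣP} Sh_N b` -/

section Cor

variable {G : Type u} [Group G] [TopologicalSpace G] [IsTopologicalGroup G] [CompactSpace G] [T2Space G] [TotallyDisconnectedSpace G]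
variable {MX MY MZ : Type u} [AddCommGroup MX] [TopologicalSpace MX] [DiscreteTopology MX] [AddCommGroup MY] [TopologicalSpace MY] [DiscreteTopology MY]
  [AddCommGroup MZ] [TopologicalSpace MZ] [DiscreteTopology MZ]
variable (ρX : ContinuousRep G ℤ MX) (ρY : ContinuousRep G ℤ MY) (ρZ : ContinuousRep G ℤ MZ)
  (P : ContPairing ρX.toTopRep ρY.toTopRep ρZ.toTopRep)
  (N : Subgroup G) [hNc : IsClosed (N : Set G)] [Fintype (G ⧸ N)] (hN : IsOpen (N : Set G))
  {s : G ⧸ N → G} (hs : ∀ x : G ⧸ N, (s x : G ⧸ N) = x) (hs1 : s ((1 : G) : G ⧸ N) = 1)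

omit [T2Space G] [TotallyDisconnectedSpace G] hNc in
/-- `trace(φ ·_{pt} ψ) = Σ_y P(φ y, ψ y) = ⟨φ, ψ⟩_N`: the trace of the pointwise pairing is the tree's SUMMED pairing `P.coindFin N`.
[cite: NeukirchSchmidtWingberg2008, I §5 Prop. (1.5.3)(iv)] -/
theorem coindOpenTrace_coindFinPt (φ : coindFin ρX.toTopRep N) (ψ : coindFin ρY.toTopRep N) :
    (ρZ.coindOpenTrace N hN).hom ((coindFinPt P N).toLin φ ψ) = (P.coindFin N).toLin φ ψ := by
  rw [ContinuousRep.coindOpenTrace_apply, ContPairing.coindFin_toLin_apply]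
  rfl

omit [CompactSpace G] [T2Space G] [TotallyDisconnectedSpace G] hNc [Fintype (G ⧸ N)] in
/-- **`H¹(N ↪ G, ev₁)(Sh_N a) = a`**: the degree-one Shapiro map `φ ↦ φ(1·N)` undoes the Shapiro lift (`evalOne ∘ Sh = id` on cocycles, tree
`evalOne_shapiroCocycle`). [cite: NeukirchSchmidtWingberg2008, I §6 Prop. (1.6.4)] -/
theorem map_coindFinEvalAtOne_shapiroLift (a : continuousCohomology 1 (subgroupRep ρX.toTopRep N)) :
    ContinuousCohomology.map (subgroupIncl N) (coindFinEvalAtOne ρX.toTopRep N) 1 (shapiroLift ρX.toTopRep N hN hs hs1 a) = a := by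
  obtain ⟨f, rfl⟩ := oneCocycleClass_surjective _ a
  rw [shapiroLift_oneCocycleClass, map_oneCocycleClass]
  have h : contOneCocycles.pullback (subgroupIncl N) (coindFinEvalAtOne ρX.toTopRep N) (shapiroCocycle ρX.toTopRep N hN hs f) =
      evalOne ρX.toTopRep N (shapiroCocycle ρX.toTopRep N hN hs f) := by
    refine Subtype.ext (ContinuousMap.ext fun h => ?_)
    rw [contOneCocycles.pullback_apply, evalOne_apply]
    rfl
  rw [h, evalOne_shapiroCocycle ρX.toTopRep N hN hs hs1]

/-- ★★ **The two models of the layer pairing agree: `cor_N(a ∪ b) = Sh_N a ∪_{ΣP} Sh_N b` in `H²(G, Z)`** for a profinite `G`, an open subgroup `N` of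
finite index, discrete coefficients, a continuous equivariant pairing `P : X × Y → Z`, `a ∈ H¹(N, X)`, `b ∈ H¹(N, Y)` (`cor` = Serre's all-degree corestriction
of `Corestriction.lean`, `Sh_N` the Shapiro lifts, `ΣP = P.coindFin N` the summed pairing). Proof: `cor_N (sh_N w) = H²(trace) w` (tree
`ContinuousRep.cor_shapiroCoindFinAddEquiv`) for `w := Sh a ∪_{pt} Sh b`; `sh_N w = a ∪ b` by naturality of the cup product along `(N ↪ G, ev₁)` and
`ev₁ ∘ Sh = id`; `H²(trace) w = Sh a ∪_{ΣP} Sh b` by naturality along the trace. [cite: SerreGaloisCohomology1997, I §2.5 (corestriction)]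
[cite: NeukirchSchmidtWingberg2008, I §5 Prop. (1.5.3)(iv) and I §6 Prop. (1.6.4)] -/
theorem cor_cupProduct_eq_cupProduct_shapiroLift (a : continuousCohomology 1 (subgroupRep ρX.toTopRep N))
    (b : continuousCohomology 1 (subgroupRep ρY.toTopRep N)) :
    cor N ρZ 2 ((resPairing N ρX ρY ρZ P).cupProduct a b) =
      (P.coindFin N).cupProduct (shapiroLift ρX.toTopRep N hN hs hs1 a) (shapiroLift ρY.toTopRep N hN hs hs1 b) := by
  -- `w := Sh a ∪_{pt} Sh b ∈ H²(G, Maps(G ⧸ N, Z))`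
  set w : continuousCohomology 2 (coindFin.{0, u} ρZ.toTopRep N) :=
    (coindFinPt P N).cupProduct (shapiroLift ρX.toTopRep N hN hs hs1 a) (shapiroLift ρY.toTopRep N hN hs hs1 b) with hw
  -- (i) `sh_N w = a ∪ b`
  have hsh : ρZ.shapiroCoindFinAddEquiv N hN 2 w = (resPairing N ρX ρY ρZ P).cupProduct a b := by
    rw [ContinuousRep.shapiroCoindFinAddEquiv_apply, hw]
    have h1 := ContPairing.cupProduct_mapPair (coindFinPt P N) (resPairing N ρX ρY ρZ P) (subgroupIncl N) (coindFinEvalAtOne ρX.toTopRep N)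
      (coindFinEvalAtOne ρY.toTopRep N) (coindFinEvalAtOne ρZ.toTopRep N) (fun φ ψ => coindFinEvalAtOne_coindFinPt P N φ ψ)
      (shapiroLift ρX.toTopRep N hN hs hs1 a) (shapiroLift ρY.toTopRep N hN hs hs1 b)
    have h2 : ContinuousCohomology.map (subgroupIncl N) (Y := (ρX.restrict (subgroupIncl N)).toTopRep) (coindFinEvalAtOne ρX.toTopRep N) 1
        (shapiroLift ρX.toTopRep N hN hs hs1 a) = a :=
      map_coindFinEvalAtOne_shapiroLift ρX N hN hs hs1 a
    have h3 : ContinuousCohomology.map (subgroupIncl N) (Y := (ρY.restrict (subgroupIncl N)).toTopRep) (coindFinEvalAtOne ρY.toTopRep N) 1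
        (shapiroLift ρY.toTopRep N hN hs hs1 b) = b :=
      map_coindFinEvalAtOne_shapiroLift ρY N hN hs hs1 b
    rw [h2, h3] at h1
    exact h1
  -- (ii) `H²(trace) w = Sh a ∪_{ΣP} Sh b`
  have htr : cohomologyMap (ρZ.coindOpenTrace N hN : coindFin.{0, u} ρZ.toTopRep N ⟶ ρZ.toTopRep) 2 w =
      (P.coindFin N).cupProduct (shapiroLift ρX.toTopRep N hN hs hs1 a) (shapiroLift ρY.toTopRep N hN hs hs1 b) := by
    have h4 := ContPairing.cupProduct_map (coindFinPt P N) (P.coindFin N) (𝟙 _) (𝟙 _)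
      (ρZ.coindOpenTrace N hN : coindFin.{0, u} ρZ.toTopRep N ⟶ ρZ.toTopRep)
      (fun φ ψ => coindOpenTrace_coindFinPt ρX ρY ρZ P N hN φ ψ)
      (shapiroLift ρX.toTopRep N hN hs hs1 a) (shapiroLift ρY.toTopRep N hN hs hs1 b)
    rw [cohomologyMap_id_apply, cohomologyMap_id_apply] at h4
    rw [hw]
    exact h4
  rw [← hsh, ContinuousRep.cor_shapiroCoindFinAddEquiv, htr]

end Cor

/-! ## §3. The number-field instance: `localPairingSubgroup = inv_v(Sh a ∪_Σ Sh b)` -/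

section Local

open NumberField IsDedekindDomain

-- as in `LocalPairingSubgroup.lean`: compactness of absolute Galois groups and of closed subgroups are local instances only.
attribute [local instance] absoluteGaloisGroup_compactSpace compactSpace_of_isClosed_subgroup

variable (K : Type) [Field K] [NumberField K] (n : ℕ) [NeZero n] (v : HeightOneSpectrum (𝓞 K))
variable {MX MY : Type} [AddCommGroup MX] [TopologicalSpace MX] [DiscreteTopology MX] [AddCommGroup MY] [TopologicalSpace MY] [DiscreteTopology MY]
variable (ρX : ContinuousRep (Field.absoluteGaloisGroup (v.adicCompletion K)) ℤ MX) (ρY : ContinuousRep (Field.absoluteGaloisGroup (v.adicCompletion K)) ℤ MY)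
  (P : ContPairing ρX.toTopRep ρY.toTopRep (muAt K n v).toTopRep)
variable (S : Subgroup (Field.absoluteGaloisGroup (v.adicCompletion K))) [hS : IsClosed (S : Set (Field.absoluteGaloisGroup (v.adicCompletion K)))]
  [Fintype (Field.absoluteGaloisGroup (v.adicCompletion K) ⧸ S)] (hSo : IsOpen (S : Set (Field.absoluteGaloisGroup (v.adicCompletion K))))
  {s : Field.absoluteGaloisGroup (v.adicCompletion K) ⧸ S → Field.absoluteGaloisGroup (v.adicCompletion K)}
  (hs : ∀ x, (s x : Field.absoluteGaloisGroup (v.adicCompletion K) ⧸ S) = x) (hs1 : s ((1 : Field.absoluteGaloisGroup (v.adicCompletion K)) : _ ⧸ S) = 1)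

/-- ★★ **J3's local pairing on an open subgroup IS the Shapiro-model layer pairing**: `⟨a, b⟩_S = inv_v(cor_{Γ_{K_v}/S}(a ∪ b)) = inv_v(Sh_S a ∪_{ΣP} Sh_S b)`
for `a ∈ H¹(S, X)`, `b ∈ H¹(S, Y)` (the left side is the tree's `localPairingSubgroup`, the currency of `SmallImageRttD2Seq.pairLoc`; the right side is the
currency of the tree's levelwise reciprocity core and of its Mackey evaluation). [cite: SerreLocalFields1979, XI §2 Prop. 1 (ii)]
[cite: NeukirchSchmidtWingberg2008, I §5 Prop. (1.5.3)(iv) and I §6 Prop. (1.6.4)] -/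
theorem localPairingSubgroup_eq_localInvariantMap_cupProduct_shapiroLift
    (a : continuousCohomology 1 (subgroupRep ρX.toTopRep S)) (b : continuousCohomology 1 (subgroupRep ρY.toTopRep S)) :
    localPairingSubgroup K n v ρX ρY P S a b =
      localInvariantMap K n v ((P.coindFin S).cupProduct (shapiroLift ρX.toTopRep S hSo hs hs1 a) (shapiroLift ρY.toTopRep S hSo hs hs1 b)) := by
  rw [localPairingSubgroup_apply, localInvariantMapSubgroup_apply, cor_cupProduct_eq_cupProduct_shapiroLift ρX ρY (muAt K n v) P S hSo hs hs1]

end Local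

end Summit.BirchSwinnertonDyer.BirchSwinnertonDyer.Theorems.SmallImageRttD2Seq

end
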